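import Summits.PneNP.PneNP.Theorems.PeaTwoMemBPP.Negative.GadgetLogSum

/-!
# PneNP / SzkEntropy — crux `PeaTwoMemBPP` (stmt-PneNP-10778), negative side, support: cell structure of a gadget and the `7`-adic step

Route `PneNP/SzkEntropy`, crux stmt-PneNP-10778.  Third support file for `GadgetReduction.lean`, specialised to
the gadget space `F₂³ × F₂ˢ` with slices `ξ ∈ F₂³` and outputs in `F₂ᵗ`.  Under SLICE-CONSTANCY of `A`
(`A` constant on every `Vx b ξ`, i.e. `A = F(ξ, B)`) and EQUIDISTRIBUTION (`8|Vx b ξ| = |V b|`, i.e. `B ⊥ ξ`):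
`m_b = |V b|/8` (`mB`), the slice value `sliceVal`, the counts `wB b a = #{ξ : sliceVal b ξ = a}`,
`|Va b a| = m_b·w_b(a)` (`card_cellVa_eq`), and

* `wB_one_mem` — **the `7`-adic step**: the fibre-product identity `(∏_y|V|)·7^{7·2ˢ} = (∏_y|Va|)·2^{24·2ˢ}`
  (the cardinality form of "exact on `(μ)` and `(μ + y₀)`", i.e. `H(A | B) = h(1/8)`) forces `w_b(1) ∈ {1, 7}`
  on every nonempty cell, because `w^w (8−w)^{8−w}` has a prime factor `2` or `3` for every other `w ≤ 8` —
  the arithmetic shadow of the ℚ-independence of `log₂3, log₂5, log₂7`;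
* `point_structure` — such an `F` is a point indicator up to complement, `F = c + [ξ = a]`;
* `nu_factor` — the `q5` slice counts on a pointed cell, by enumeration (`12¹²·4⁴` versus `10¹⁰·6⁶`).

References: T. Cover, J. Thomas, *Elements of Information Theory*, 2nd ed., §2.2 (conditional entropy);
the divisibility facts are checked by `decide`.
-/

namespace Summit.PneNP.PneNP.Theorems.PeaTwoMemBPP.Negative

open Finset Literature.InformationTheory.Entropy

/-! ### Structure of a gadget from slice-constancy and equidistribution -/

section Structure

variable {s t : ℕ}
variable (A : (Fin 3 → ZMod 2) × (Fin s → ZMod 2) → ZMod 2)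
variable (B : (Fin 3 → ZMod 2) × (Fin s → ZMod 2) → (Fin t → ZMod 2))

/-- The slice size `m_b = |V b| / 8`. -/
def mB (b : Fin t → ZMod 2) : ℕ := (cellV B b).card / 8

/-- The value of `A` on the slice `(b, x)` (junk `0` if the slice is empty). -/
noncomputable def sliceVal (b : Fin t → ZMod 2) (x : Fin 3 → ZMod 2) : ZMod 2 :=
  if h : (cellVx B Prod.fst b x).Nonempty then A h.choose else 0

/-- The number of slices of the cell `b` on which `A` takes the value `a`. -/
noncomputable def wB (b : Fin t → ZMod 2) (a : ZMod 2) : ℕ :=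
  (Finset.univ.filter fun x : Fin 3 → ZMod 2 => sliceVal A B b x = a).card

/-- `|F₂³| = 8`. [folklore] -/
theorem card_X : Fintype.card (Fin 3 → ZMod 2) = 8 := by
  rw [Fintype.card_fun, ZMod.card, Fintype.card_fin]; rfl

/-- `|F₂³ × F₂ˢ| = 8·2ˢ`. [folklore] -/
theorem card_G : Fintype.card ((Fin 3 → ZMod 2) × (Fin s → ZMod 2)) = 8 * 2 ^ s := by
  rw [Fintype.card_prod, card_X, Fintype.card_fun, ZMod.card, Fintype.card_fin]

variable {A B}

/-- Under equidistribution every slice has `m_b` points … -/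
theorem card_cellVx_eq (hind : ∀ b x, 8 * (cellVx B Prod.fst b x).card = (cellV B b).card)
    (b : Fin t → ZMod 2) (x : Fin 3 → ZMod 2) : (cellVx B Prod.fst b x).card = mB B b := by
  unfold mB
  have h := hind b x
  omega

/-- … and the cell has `8 m_b`. -/
theorem card_cellV_eq (hind : ∀ b x, 8 * (cellVx B Prod.fst b x).card = (cellV B b).card)
    (b : Fin t → ZMod 2) : (cellV B b).card = 8 * mB B b := by
  have h := hind b 0
  rw [card_cellVx_eq hind] at h
  exact h.symm

/-- `Σ_b m_b = 2ˢ`. [folklore] -/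
theorem sum_mB_eq (hind : ∀ b x, 8 * (cellVx B Prod.fst b x).card = (cellV B b).card) :
    ∑ b, mB B b = 2 ^ s := by
  have h1 : ∑ b, (cellV B b).card = 8 * 2 ^ s := by
    rw [← card_G (s := s), ← Finset.card_univ,
      Finset.card_eq_sum_card_fiberwise (f := B) (t := Finset.univ) fun _ _ => Finset.mem_univ _]
    rfl
  have h2 : ∑ b, (cellV B b).card = ∑ b, 8 * mB B b := Finset.sum_congr rfl fun b _ => card_cellV_eq hind b
  rw [h2, ← Finset.mul_sum] at h1
  omega

/-- On a slice, `A` is the slice value (given slice-constancy of `A`). -/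
theorem A_eq_sliceVal (hA : ∀ y y' : (Fin 3 → ZMod 2) × (Fin s → ZMod 2), B y' = B y → y'.1 = y.1 → A y' = A y)
    {b : Fin t → ZMod 2} {x : Fin 3 → ZMod 2} {y : (Fin 3 → ZMod 2) × (Fin s → ZMod 2)}
    (hy : y ∈ cellVx B Prod.fst b x) : A y = sliceVal A B b x := by
  unfold sliceVal
  have hne : (cellVx B Prod.fst b x).Nonempty := ⟨y, hy⟩
  rw [dif_pos hne]
  have hc := hne.choose_spec
  simp only [cellVx, Finset.mem_filter, Finset.mem_univ, true_and] at hy hc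
  exact (hA _ _ (hc.1.trans hy.1.symm) (hc.2.trans hy.2.symm)).symm

/-- `|Vxa b x a| = m_b·[sliceVal b x = a]`. -/
theorem card_cellVxa_eq (hind : ∀ b x, 8 * (cellVx B Prod.fst b x).card = (cellV B b).card)
    (hA : ∀ y y' : (Fin 3 → ZMod 2) × (Fin s → ZMod 2), B y' = B y → y'.1 = y.1 → A y' = A y)
    (b : Fin t → ZMod 2) (x : Fin 3 → ZMod 2) (a : ZMod 2) :
    (cellVxa A B Prod.fst b x a).card = if sliceVal A B b x = a then mB B b else 0 := by
  rw [cellVxa_eq_filter]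
  by_cases h : sliceVal A B b x = a
  · rw [if_pos h, ← card_cellVx_eq hind b x]
    congr 1
    exact Finset.filter_true_of_mem fun y hy => (A_eq_sliceVal hA hy).trans h
  · rw [if_neg h, Finset.card_eq_zero, Finset.filter_eq_empty_iff]
    intro y hy hAy
    exact h ((A_eq_sliceVal hA hy).symm.trans hAy)

/-- `|Va b a| = m_b · w_b(a)`. -/
theorem card_cellVa_eq (hind : ∀ b x, 8 * (cellVx B Prod.fst b x).card = (cellV B b).card)
    (hA : ∀ y y' : (Fin 3 → ZMod 2) × (Fin s → ZMod 2), B y' = B y → y'.1 = y.1 → A y' = A y)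
    (b : Fin t → ZMod 2) (a : ZMod 2) : (cellVa A B b a).card = mB B b * wB A B b a := by
  have split : (cellVa A B b a).card = ∑ x, (cellVxa A B Prod.fst b x a).card := by
    rw [Finset.card_eq_sum_ones, ← Finset.sum_fiberwise (cellVa A B b a) Prod.fst (fun _ => 1)]
    refine Finset.sum_congr rfl fun x _ => ?_
    rw [← Finset.card_eq_sum_ones]
    congr 1
    ext y; simp [cellVa, cellVxa]; tauto
  rw [split, Finset.sum_congr rfl fun x _ => card_cellVxa_eq hind hA b x a, wB, Finset.card_filter,
    Finset.mul_sum]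
  refine Finset.sum_congr rfl fun x _ => ?_
  split_ifs <;> simp

/-- `w_b(0) + w_b(1) = 8`. -/
theorem wB_zero_add_wB_one (b : Fin t → ZMod 2) : wB A B b 0 + wB A B b 1 = 8 := by
  unfold wB
  have h := Finset.card_filter_add_card_filter_not
    (s := (Finset.univ : Finset (Fin 3 → ZMod 2))) (p := fun x => sliceVal A B b x = 0)
  rw [Finset.card_univ, card_X] at h
  have e : (Finset.univ.filter fun x : Fin 3 → ZMod 2 => ¬ sliceVal A B b x = 0) =
      Finset.univ.filter fun x => sliceVal A B b x = 1 := by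
    refine Finset.filter_congr fun x _ => ?_
    generalize sliceVal A B b x = p; revert p; decide
  rw [e] at h
  exact h

/-! #### The `7`-adic step: `w_b(1) ∈ {1, 7}` -/

/-- `g(w) = wʷ (8 − w)^{8−w}`. -/
def gW (w : ℕ) : ℕ := w ^ w * (8 - w) ^ (8 - w)

/-- For `w ≤ 8` other than `1, 7`, `g(w)` has a prime factor `2` or `3`. [folklore] -/
theorem two_or_three_dvd_gW {w : ℕ} (hw : w ≤ 8) (h1 : w ≠ 1) (h7 : w ≠ 7) : 2 ∣ gW w ∨ 3 ∣ gW w := by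
  unfold gW
  interval_cases w <;> first | exact absurd rfl h1 | exact absurd rfl h7 | decide

/-- Per-cell evaluation of the `q2` fibre factor: `|Va b 0|^{|Va b 0|} |Va b 1|^{|Va b 1|} = m_b^{8 m_b} g(w_b(1))^{m_b}`. -/
theorem cellVa_factor_eq (hind : ∀ b x, 8 * (cellVx B Prod.fst b x).card = (cellV B b).card)
    (hA : ∀ y y' : (Fin 3 → ZMod 2) × (Fin s → ZMod 2), B y' = B y → y'.1 = y.1 → A y' = A y)
    (b : Fin t → ZMod 2) :
    (cellVa A B b 0).card ^ (cellVa A B b 0).card * (cellVa A B b 1).card ^ (cellVa A B b 1).card =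
      mB B b ^ (8 * mB B b) * gW (wB A B b 1) ^ mB B b := by
  rw [card_cellVa_eq hind hA, card_cellVa_eq hind hA]
  set m := mB B b
  set w1 := wB A B b 1
  have hw : wB A B b 0 = 8 - w1 := by have := wB_zero_add_wB_one (A := A) (B := B) b; omega
  rw [hw, gW]
  have hw1 : w1 ≤ 8 := by have := wB_zero_add_wB_one (A := A) (B := B) b; omega
  -- (m(8-w))^{m(8-w)} (m w)^{m w} = m^{8m} (w^w (8-w)^{8-w})^m
  rw [mul_pow, mul_pow, mul_pow, ← pow_mul, ← pow_mul, show m ^ (m * (8 - w1)) * (8 - w1) ^ (m * (8 - w1)) *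
      (m ^ (m * w1) * w1 ^ (m * w1)) = m ^ (m * (8 - w1) + m * w1) * ((8 - w1) ^ (m * (8 - w1)) * w1 ^ (m * w1)) by
    rw [pow_add]; ring]
  have e1 : m * (8 - w1) + m * w1 = 8 * m := by
    rw [← mul_add, Nat.sub_add_cancel hw1, mul_comm]
  rw [e1, mul_comm m (8 - w1), pow_mul, mul_comm m w1, pow_mul]
  ring

/-- **The `7`-adic step.**  If `(∏_y |V(B y)|)·7^{7·2ˢ} = (∏_y |Va(B y, A y)|)·2^{24·2ˢ}` (the fibre-product
form of "exact on `(μ)` and `(μ + y₀)`") then every nonempty cell has `w_b(1) ∈ {1, 7}`. -/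
theorem wB_one_mem (hind : ∀ b x, 8 * (cellVx B Prod.fst b x).card = (cellV B b).card)
    (hA : ∀ y y' : (Fin 3 → ZMod 2) × (Fin s → ZMod 2), B y' = B y → y'.1 = y.1 → A y' = A y)
    (hE : (∏ y, (cellV B (B y)).card) * 7 ^ (7 * 2 ^ s) =
      (∏ y, (cellVa A B (B y) (A y)).card) * 2 ^ (24 * 2 ^ s))
    (b : Fin t → ZMod 2) (hb : 0 < mB B b) : wB A B b 1 = 1 ∨ wB A B b 1 = 7 := by
  -- evaluate both products cell by cell
  have hL : ∏ y, (cellV B (B y)).card = ∏ b, (8 * mB B b) ^ (8 * mB B b) := by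
    rw [show (∏ y, (cellV B (B y)).card) = fibProd B from rfl, fibProd_eq_prod_pow]
    refine Finset.prod_congr rfl fun b _ => ?_
    rw [show (Finset.univ.filter fun w => B w = b) = cellV B b from rfl, card_cellV_eq hind]
  have hR : ∏ y, (cellVa A B (B y) (A y)).card = ∏ b, mB B b ^ (8 * mB B b) * gW (wB A B b 1) ^ mB B b := by
    rw [show (∏ y, (cellVa A B (B y) (A y)).card) = fibProd (q2 A B) from (fibProd_q2 A B).symm,
      fibProd_eq_prod_pow, Fintype.prod_prod_type, Finset.prod_comm]
    refine Finset.prod_congr rfl fun b _ => ?_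
    have e : ∀ a : ZMod 2, (Finset.univ.filter fun w => q2 A B w = (a, b)) = cellVa A B b a := by
      intro a; ext w; simp [q2, cellVa, Prod.mk.injEq, and_comm]
    rw [prod_zmod2, e, e, cellVa_factor_eq hind hA]
  have h8 : ∏ b : Fin t → ZMod 2, (8 * mB B b) ^ (8 * mB B b) =
      8 ^ (8 * 2 ^ s) * ∏ b, mB B b ^ (8 * mB B b) := by
    rw [← sum_mB_eq hind, Finset.mul_sum, ← Finset.prod_pow_eq_pow_sum, ← Finset.prod_mul_distrib]
    refine Finset.prod_congr rfl fun b _ => ?_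
    rw [mul_pow]
  rw [hL, hR, h8, Finset.prod_mul_distrib] at hE
  -- cancel the common positive factor
  have hMpos : 0 < ∏ b : Fin t → ZMod 2, mB B b ^ (8 * mB B b) :=
    Finset.prod_pos fun b _ => by
      rcases Nat.eq_zero_or_pos (mB B b) with h | h
      · rw [h]; simp
      · exact pow_pos h _
  have key : 7 ^ (7 * 2 ^ s) = ∏ b, gW (wB A B b 1) ^ mB B b := by
    have e8 : (8 : ℕ) ^ (8 * 2 ^ s) = 2 ^ (24 * 2 ^ s) := by
      rw [show (8 : ℕ) = 2 ^ 3 by norm_num, ← pow_mul]; ring_nf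
    rw [e8] at hE
    have : 2 ^ (24 * 2 ^ s) * (∏ b : Fin t → ZMod 2, mB B b ^ (8 * mB B b)) * 7 ^ (7 * 2 ^ s) =
        2 ^ (24 * 2 ^ s) * (∏ b : Fin t → ZMod 2, mB B b ^ (8 * mB B b)) * ∏ b, gW (wB A B b 1) ^ mB B b := by
      linear_combination hE
    have hpos : 0 < 2 ^ (24 * 2 ^ s) * ∏ b : Fin t → ZMod 2, mB B b ^ (8 * mB B b) := by positivity
    exact Nat.eq_of_mul_eq_mul_left hpos this
  -- divisibility
  by_contra hw
  push Not at hw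
  have hw8 : wB A B b 1 ≤ 8 := by have := wB_zero_add_wB_one (A := A) (B := B) b; omega
  have hdvd : gW (wB A B b 1) ∣ 7 ^ (7 * 2 ^ s) := by
    rw [key]
    exact (dvd_pow_self _ hb.ne').trans (Finset.dvd_prod_of_mem _ (Finset.mem_univ b))
  rcases two_or_three_dvd_gW hw8 hw.1 hw.2 with h2 | h3
  · have : (2 : ℕ) ∣ 7 := Nat.Prime.dvd_of_dvd_pow Nat.prime_two (h2.trans hdvd)
    omega
  · have : (3 : ℕ) ∣ 7 := Nat.Prime.dvd_of_dvd_pow Nat.prime_three (h3.trans hdvd)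
    omega

/-! #### Point structure on a cell and the `5`-adic step -/

/-- A Boolean function on `F₂³` taking the value `1` exactly once or exactly seven times is a point indicator
up to complement: `F x = c + [x = a]`. [folklore] -/
theorem point_structure (F : (Fin 3 → ZMod 2) → ZMod 2)
    (h : (Finset.univ.filter fun x => F x = 1).card = 1 ∨ (Finset.univ.filter fun x => F x = 1).card = 7) :
    ∃ (a : Fin 3 → ZMod 2) (c : ZMod 2), ∀ x, F x = c + if x = a then 1 else 0 := by
  have dich : ∀ p : ZMod 2, p ≠ 1 → p = 0 := by decide
  have dich' : ∀ p : ZMod 2, ¬ p = 0 ↔ p = 1 := by decide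
  rcases h with h1 | h7
  · obtain ⟨a, ha⟩ := Finset.card_eq_one.1 h1
    refine ⟨a, 0, fun x => ?_⟩
    have hx : F x = 1 ↔ x = a := by
      have := Finset.ext_iff.1 ha x
      simpa using this
    by_cases hxa : x = a
    · rw [if_pos hxa, zero_add]; exact hx.2 hxa
    · rw [if_neg hxa, add_zero]; exact dich _ fun h => hxa (hx.1 h)
  · have hc := Finset.card_filter_add_card_filter_not
      (s := (Finset.univ : Finset (Fin 3 → ZMod 2))) (p := fun x => F x = 1)
    rw [h7, Finset.card_univ, card_X] at hc
    have h0 : (Finset.univ.filter fun x : Fin 3 → ZMod 2 => ¬ F x = 1).card = 1 := by omega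
    obtain ⟨a, ha⟩ := Finset.card_eq_one.1 h0
    refine ⟨a, 1, fun x => ?_⟩
    have hx : ¬ F x = 1 ↔ x = a := by
      have := Finset.ext_iff.1 ha x
      simpa using this
    by_cases hxa : x = a
    · rw [if_pos hxa]; exact (dich _ (hx.2 hxa)).trans (by decide)
    · rw [if_neg hxa, add_zero]
      by_contra hF
      exact hxa (hx.1 hF)

/-- The `q5` slice count `ν(v) = Σ_x #{z : c + [x = a] + x_l·z = v}` and its fibre factor, by enumeration:
`ν(0)^{ν(0)} ν(1)^{ν(1)} = 12¹²·4⁴` if `a_l = 1` and `= 10¹⁰·6⁶` if `a_l = 0`. [folklore] -/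
theorem nu_factor (a : Fin 3 → ZMod 2) (c : ZMod 2) (l : Fin 3) :
    (∑ x : Fin 3 → ZMod 2, ((Finset.univ : Finset (ZMod 2)).filter fun z =>
        c + (if x = a then 1 else 0) + x l * z = 0).card) ^
      (∑ x : Fin 3 → ZMod 2, ((Finset.univ : Finset (ZMod 2)).filter fun z =>
        c + (if x = a then 1 else 0) + x l * z = 0).card) *
    (∑ x : Fin 3 → ZMod 2, ((Finset.univ : Finset (ZMod 2)).filter fun z =>
        c + (if x = a then 1 else 0) + x l * z = 1).card) ^
      (∑ x : Fin 3 → ZMod 2, ((Finset.univ : Finset (ZMod 2)).filter fun z =>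
        c + (if x = a then 1 else 0) + x l * z = 1).card) =
    if a l = 1 then 12 ^ 12 * 4 ^ 4 else 10 ^ 10 * 6 ^ 6 := by
  revert a c l
  decide

/-- `5 ∣ 10¹⁰·6⁶` and `5 ∤ 12¹²·4⁴`-type facts used below. [folklore] -/
theorem five_dvd_G0 : 5 ∣ 10 ^ 10 * 6 ^ 6 := by decide

end Structure



end Summit.PneNP.PneNP.Theorems.PeaTwoMemBPP.Negative
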